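import Summits.QuantumFields.BalabanUV.T4Continuum.Support.NE9Lemma1RemainderSpecies
import Summits.QuantumFields.BalabanUV.T4Continuum.Support.NE9RemainderPieceAdditive
import Summits.QuantumFields.BalabanUV.T4Continuum.Support.NE9RemainderPieceLinear

/-!
# NE9Lemma1RemainderSpeciesAdditive — S3 for the DISPLAYED species on the ANALYTIC class: the piece-additivity binder
# `PieceAdditiveOn (analyticClass D.R) D.toC` of the owner's class-relative piece form DISCHARGED from the additivity of the
# (1.23)-functional in the old term (`NE9RemainderPieceAdditive.remPiece_sub`), whence `ChannelAdditive` and the four S-binders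
# of the NE9 END at once for that species (cell `pub-balaban`, T4-DAG §2 node U3 / §6 NE9; crew row (w16) of the row OWNER's
# ruling CLAIMS l.8684, unit b2b-balaban-t4-ne9-formalise-leaf-08 gen 4; part 3 after the owner's parts 1–2
# `NE9Lemma1PieceClass` / `NE9Lemma1RemainderSpecies`)

HONEST FRAMING (T4-DAG PAGE 1).  Rung (B)+1 of the FINITE-VOLUME T⁴ programme — NOT infinite volume, NOT a mass gap, NOT the
Clay problem.  NE9 (`T4OutputRate.NE9` ∧ `FadingMemory`) is a cell NEW ESTIMATE, NOT PRINTED, NOT discharged here; spine 0/9;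
0/18 skeleton leaves instantiated on Bałaban's objects (O-NE9-1).  HONEST DEPENDENCY (cell line, verbatim): continuum YM on
T⁴ ⇐ BetaPertH ∧ nine spine estimates (0/9 proved); BetaPertH ⇐ (D1) ∧ (D4) ∧ CAP+tail; G-an2-4 gates asym, D1 and NE2/3/4.
`FlowStep.BetaPertH`, (B), (B^μ) do not occur.  [II] = [Balaban1988RG2Cluster] (CMP **116**) is quoted for TYPES only
(ABSOLUTE RULE: nothing printed in the audited series is asserted).

WHERE THIS SITS (skeleton `t4/b2b-balaban-t4-ne9-p1/SKELETON-NE9-P1.md` §3 rows S3/S5).  The owner's part 2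
(`NE9Lemma1RemainderSpecies`, gen 24) inhabits the class-relative piece form with the displayed species — piece at (X, re/im)
:= Re/Im `remPiece e^{κ₁} r_k cubes (lift H X) 5 dir s₀ σ₀` — and PROVES `PieceZero`, `PieceLocal`, `PieceBoundOnG` (S5) on the
analytic class; it records what it leaves: *NOT PROVED here: `PieceAdditiveOn` (linearity of (1.23) in the old term …) — it is
needed for `ChannelAdditive` (S3)*, as the implication `channelAdditive_rem_of_pieceAdditive`.  THIS FILE closes it:
* `pieceAdditiveOn_rem` — `PieceAdditiveOn (analyticClass D.R) D.toC` from `NE9RemainderPieceAdditive.remPiece_sub` BY NAME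
  (`lift` is subtractive, `reIm` is subtractive, the σ-circle radius `e^{κ₁} > 1`, `r_k > 0`, both lifts analytic on the ball
  of radius `R_X` because `H₁, H₂ ∈ analyticClass D.R`), under the DIRECTION-REGULARITY binders (displayed, instantiation-side
  — TYPE [II] (1.21)/(1.23) p. 7: the contour directions *"(tζ̃_□ + t_□ζ_□)𝐇_k(σ(Y₀), B′)"* depend continuously on
  (t_□, s, σ) and lie in the analyticity domain *"𝔘^c_{k+1}(□₀,(1+2β)α₀,(1+2β)α₁,α₀)"*): `hdirC` (joint continuity of
  `D.dir k s y a b x` in (t, s, σ)) and `hdirR` (‖dir‖ < R_X everywhere — off the contours a harmless convention, the functional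
  reads the directions on the contours only); the one complex-analysis input — for `H` analytic on the ball of radius `R_X`,
  `A ↦ dirRem H 5 A` is continuous on that ball, boundedness-free — is leaf-03's `NE9RemainderPieceLinear.continuousOn_dirRem_ball`
  BY NAME (`pieceAdditiveOn_rem_of_cont` keeps it as a displayed hypothesis `hcont` for channels on other radii/classes);
* `channelAdditive_rem` — S3 `ChannelAdditive (analyticClass D.R) (cpieceChannel D.toC)` (owner's implication fed);
* `sBinders_rem` — S3 ∧ S4 (`ChannelLocal`, `ChannelStepSum`) ∧ S5 (`ChannelSizeAtStepNN`) for the species on the analytic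
  class at once, the latter three the owner's part 2 BY NAME (`structureBinders_rem`, `channelSizeAtStepNN_rem`).
So, for the displayed species, the four channel-structure binders of the END are KERNEL modulo: O1, the printed-TYPE binders
`RemData.Admissible` (domain inclusion (I.3.36), G1, radii), the level counts (1.26)–(1.28), and the direction regularity
(`hdirC`, `hdirR`).  DISGUISE TEST: one input family pair, one history; additivity of a linear functional — not NE9.

References (TYPES only): [Balaban1988RG2Cluster] T. Bałaban, *Renormalization group approach to lattice gauge field
theories. II*, Commun. Math. Phys. **116** (1988) 1–22, (1.21)–(1.25) p. 7 (render `b2b-balaban-ref1/pages/1988-cmp116-rg-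
II-cluster/…-p007-x2.png` re-read as image by this seat, 2026-08-20).  Summits-side NEW work (LEAN PLACEMENT RULE); imports
`NE9Lemma1RemainderSpecies` (owner, part 2), `NE9RemainderPieceAdditive` (this unit) and `NE9RemainderPieceLinear` (leaf-03)
BY NAME; modifies nothing; 0 sorry;
`[folklore]`.  Value = S3 for the displayed species at FORM level modulo displayed regularity binders, NOT summit progress.
-/

noncomputable section

namespace Summit.QuantumFields.BalabanUV.T4Continuum.NE9Lemma1RemainderSpeciesAdditive

open scoped BigOperators
open Metric Set Complex
open Literature.MathematicalPhysics.QuantumFieldTheory.Balaban1983to89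
open Literature.MathematicalPhysics.QuantumFieldTheory.Balaban1983to89.T4OutputRate
open Literature.MathematicalPhysics.QuantumFieldTheory.Balaban1983to89.T4HistoryLipschitzRecursion
open Summit.QuantumFields.BalabanUV.T4Continuum.NE9Lemma1Counting
open Summit.QuantumFields.BalabanUV.T4Continuum.NE9Lemma1Gain
open Summit.QuantumFields.BalabanUV.T4Continuum.NE9Lemma1PieceClass
open Summit.QuantumFields.BalabanUV.T4Continuum.NE9Lemma1RemainderPiece
open Summit.QuantumFields.BalabanUV.T4Continuum.NE9ComplexEncoding (doubleCarriers)
open Summit.QuantumFields.BalabanUV.T4Continuum.NE9Lemma1RemainderSpecies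
open Summit.QuantumFields.BalabanUV.T4Continuum.NE9RemainderPieceAdditive (remPiece_sub)
open Summit.QuantumFields.BalabanUV.T4Continuum.NE9RemainderPieceLinear (continuousOn_dirRem_ball)

variable {C : Carriers} {E : Type} [NormedAddCommGroup E] [NormedSpace ℂ E] {ι α β γ δ : Type} [DecidableEq δ]

/-- `reIm` is subtractive. [folklore] -/
theorem reIm_sub (b : Bool) (z₁ z₂ : ℂ) : reIm b (z₁ - z₂) = reIm b z₁ - reIm b z₂ := by
  cases b <;> simp [reIm]

/-- The σ-circle radius of (1.23) exceeds 1: `1 < e^{κ₁}` for `κ₁ > 0` (print: κ₁ ≥ 1). [folklore] -/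
theorem one_lt_exp_of_pos {κ₁ : ℝ} (h : 0 < κ₁) : 1 < Real.exp κ₁ := by
  have := Real.add_one_lt_exp h.ne'
  linarith

omit [DecidableEq δ] in
/-- The remainder family of an analytic old term along regular directions is jointly continuous in `(t, s, σ)`: composition
of the (displayed) continuity of `A ↦ dirRem H n A` on the analyticity ball with a continuous direction map that stays
inside the ball. [folklore] -/
theorem continuous_dirRem_comp {H : E → ℂ} {R : ℝ} {n : ℕ}
    (hcont : ContinuousOn (fun A => dirRem H n A) (ball 0 R)) {A : ℂ → (δ → ℝ) → (δ → ℂ) → E}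
    (hAc : Continuous fun p : ℂ × (δ → ℝ) × (δ → ℂ) => A p.1 p.2.1 p.2.2) (hAR : ∀ t s σ, ‖A t s σ‖ < R) :
    Continuous fun p : ℂ × (δ → ℝ) × (δ → ℂ) => dirRem H n (A p.1 p.2.1 p.2.2) :=
  hcont.comp_continuous hAc fun p => mem_ball_zero_iff.mpr (hAR p.1 p.2.1 p.2.2)

/-- `PieceAdditiveOn (analyticClass D.R) D.toC` with the complex-analysis input DISPLAYED (`hcont`: continuity of
`A ↦ dirRem H 5 A` on the analyticity ball) — the generic form, for reuse with other suppliers of `hcont`. [folklore] -/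
theorem pieceAdditiveOn_rem_of_cont (D : RemData C E ι α β γ δ) (hκ₁ : 0 < D.κ₁) (hr : ∀ k, 0 < D.r k)
    (hdirC : ∀ k s y a b x, Continuous fun p : ℂ × (δ → ℝ) × (δ → ℂ) => D.dir k s y a b x p.1 p.2.1 p.2.2)
    (hdirR : ∀ k s y a b x t s' σ', ‖D.dir k s y a b x t s' σ'‖ < D.R x.1)
    (hcont : ∀ (X : C.Dom) (H : E → ℂ), DifferentiableOn ℂ H (ball 0 (D.R X)) →
      ContinuousOn (fun A => dirRem H 5 A) (ball 0 (D.R X))) :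
    PieceAdditiveOn (analyticClass D.R) D.toC := by
  intro k s y a b x H₁ h₁ H₂ h₂
  show reIm x.2 (remPiece (Real.exp D.κ₁) (D.r k) (D.cubes k y a b) (lift (H₁ - H₂) x.1) 5 (D.dir k s y a b x)
      (fun _ => (0:ℝ)) (fun _ => ((Real.exp D.κ₁ : ℝ) : ℂ))) =
    reIm x.2 (remPiece (Real.exp D.κ₁) (D.r k) (D.cubes k y a b) (lift H₁ x.1) 5 (D.dir k s y a b x)
      (fun _ => (0:ℝ)) (fun _ => ((Real.exp D.κ₁ : ℝ) : ℂ))) -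
    reIm x.2 (remPiece (Real.exp D.κ₁) (D.r k) (D.cubes k y a b) (lift H₂ x.1) 5 (D.dir k s y a b x)
      (fun _ => (0:ℝ)) (fun _ => ((Real.exp D.κ₁ : ℝ) : ℂ)))
  rw [lift_sub, remPiece_sub (one_lt_exp_of_pos hκ₁) (hr k) (h₁ x.1) (h₂ x.1) (D.cubes k y a b) 5 (hdirR k s y a b x)
    (continuous_dirRem_comp (hcont x.1 _ (h₁ x.1)) (hdirC k s y a b x) (hdirR k s y a b x))
    (continuous_dirRem_comp (hcont x.1 _ (h₂ x.1)) (hdirC k s y a b x) (hdirR k s y a b x)), reIm_sub]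

/-- **`PieceAdditiveOn` FOR THE DISPLAYED SPECIES ON THE ANALYTIC CLASS (crew row (w16); the point of the module)**:
S3's piece-level binder `PieceAdditiveOn (analyticClass D.R) D.toC` — the (1.23)-pieces are SUBTRACTIVE in the old term on
the analytic class — from `NE9RemainderPieceAdditive.remPiece_sub` and `NE9RemainderPieceLinear.continuousOn_dirRem_ball`
BY NAME, under: `κ₁ > 0` (σ-circles of radius e^{κ₁} > 1), `r_k > 0`, and the DIRECTION-REGULARITY binders (displayed,
instantiation-side — TYPE [II] (1.21)/(1.23) p. 7: the directions (tζ̃_□ + t_□ζ_□)𝐇_k(σ(Y₀), B′) depend continuously on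
(t_□, s, σ) and stay inside the analyticity domain): `hdirC` joint continuity, `hdirR` strict inclusion ‖dir‖ < R_X
everywhere (a harmless convention off the contours: the functional reads the directions on the contours only).
[cite: Balaban1988RG2Cluster, (1.23) p.7] -/
theorem pieceAdditiveOn_rem (D : RemData C E ι α β γ δ) (hκ₁ : 0 < D.κ₁) (hr : ∀ k, 0 < D.r k)
    (hdirC : ∀ k s y a b x, Continuous fun p : ℂ × (δ → ℝ) × (δ → ℂ) => D.dir k s y a b x p.1 p.2.1 p.2.2)
    (hdirR : ∀ k s y a b x t s' σ', ‖D.dir k s y a b x t s' σ'‖ < D.R x.1) :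
    PieceAdditiveOn (analyticClass D.R) D.toC :=
  pieceAdditiveOn_rem_of_cont D hκ₁ hr hdirC hdirR fun _ _ hH => continuousOn_dirRem_ball hH 5

/-- **S3 FOR THE DISPLAYED SPECIES**: `ChannelAdditive (analyticClass D.R) (cpieceChannel D.toC)` — the owner's
`channelAdditive_rem_of_pieceAdditive` fed with `pieceAdditiveOn_rem`. [folklore] -/
theorem channelAdditive_rem (D : RemData C E ι α β γ δ) (hκ₁ : 0 < D.κ₁) (hr : ∀ k, 0 < D.r k)
    (hdirC : ∀ k s y a b x, Continuous fun p : ℂ × (δ → ℝ) × (δ → ℂ) => D.dir k s y a b x p.1 p.2.1 p.2.2)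
    (hdirR : ∀ k s y a b x t s' σ', ‖D.dir k s y a b x t s' σ'‖ < D.R x.1) :
    ChannelAdditive (analyticClass D.R) (cpieceChannel D.toC) :=
  channelAdditive_rem_of_pieceAdditive (pieceAdditiveOn_rem D hκ₁ hr hdirC hdirR)

/-- **ALL FOUR S-BINDERS OF THE NE9 END FOR THE DISPLAYED SPECIES ON THE ANALYTIC CLASS** (S3 ChannelAdditive — this file;
S4 ChannelLocal / ChannelStepSum and S5 ChannelSizeAtStepNN — the owner's part 2 BY NAME): under `RemData.Admissible`
(printed-TYPE binders: domain inclusion, G1, radii), the level counts, and the direction-regularity binders of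
`pieceAdditiveOn_rem` — i.e. KERNEL modulo O1, printed-TYPE binders and direction regularity. [folklore] -/
theorem sBinders_rem {D : RemData C E ι α β γ δ} {ℓ ℓ' : ℕ → ℕ → ℝ} {cdir d0 O1 cQ : ℝ}
    (hD : D.Admissible ℓ cdir d0) (hℓ : ∀ k j, 0 ≤ ℓ k j) (κ : ℝ)
    (hL : LevelCountsG D.toC.frame κ D.κ₁ O1 cQ (fun k j => ℓ k j ^ 5) ℓ') (hO1 : 0 ≤ O1)
    (hcQℓ : ∀ k j, 0 ≤ cQ * ℓ' k j)
    (hdirC : ∀ k s y a b x, Continuous fun p : ℂ × (δ → ℝ) × (δ → ℂ) => D.dir k s y a b x p.1 p.2.1 p.2.2)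
    (hdirR : ∀ k s y a b x t s' σ', ‖D.dir k s y a b x t s' σ'‖ < D.R x.1) :
    ChannelAdditive (analyticClass D.R) (cpieceChannel D.toC) ∧
      ChannelLocal (analyticClass D.R) (cpieceChannel D.toC) ∧
      ChannelStepSum (analyticClass D.R) (cpieceChannel D.toC) ∧
      ChannelSizeAtStepNN (analyticClass D.R) (cpieceChannel D.toC) κ
        (weightOf D.toC.frame D.κ₁ d0 O1 (KpOf D cdir)) (tauOfG cQ ℓ') :=
  have hκ₁ : 0 < D.κ₁ := lt_of_lt_of_le one_pos hD.κ₁_ge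
  ⟨channelAdditive_rem D hκ₁ hD.r_pos hdirC hdirR, (structureBinders_rem hD _).1, (structureBinders_rem hD _).2.1,
    channelSizeAtStepNN_rem hD hℓ κ hL hO1 hcQℓ⟩

end Summit.QuantumFields.BalabanUV.T4Continuum.NE9Lemma1RemainderSpeciesAdditive
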